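import Literature.MathematicalPhysics.QuantumManyBody.GroundStateFeynmanKacEnergyLower
import Literature.MathematicalPhysics.QuantumManyBody.GroundStateFeynmanKacWitnessBoundary
import HarnessLib

/-!
# Ground state of the Feynman–Kac semigroup, XVII: the small-time free form of the ground state

Part of the proof of `GroundStateFeynmanKac` (Chung–Zhao (1995), Thm 3.17 with Thm 3.27 /
Prop 3.29 (81)), upper-bound half `E₀ ≤ λ₀ = −log ‖T_1‖`: the input needed by the trial functions
of `GroundStateFeynmanKacTrialState.lean` (`lintegral_realKinetic_trialFn_le`) is the bound

  `eventually (t → 0+):  sqIncr t φ₀ / (2t) ≤ λ₀ − ∫ V φ₀² + ε`   (`eventually_sqIncr_div_le`)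

for the continuous ground-state function `φ₀` (`GroundStateFeynmanKacWitness*.lean`).  Proof:
`‖φ₀‖² − ⟨φ₀, T_s φ₀⟩ = 1 − μ₀^s ≤ λ₀ s` exactly (eigen-relation everywhere), the square
identity splits off `sqIncr s φ₀ / 2`, and the remainder `⟨φ₀, (P_s − T_s) φ₀⟩ ≥ 0` dominates
the interaction term `J_s` up to `O(s²)` and a killing correction
`≤ N²C M² s ∫_Λ P_x(τ_Λ ≤ s) dx = o(s)` (`tendsto_setLIntegral_not_survives`, dominated
convergence), while `J_s / s → ∫ V φ₀²` (`tendsto_interactionTerm_div`).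

## References

* K. L. Chung, Z. Zhao, *From Brownian Motion to Schrödinger's Equation* (1995), Thm 3.27,
  Prop 3.29 (81). [cite: ChungZhao1995, Prop 3.29]
-/

noncomputable section

namespace Literature.MathematicalPhysics.QuantumManyBody.BoseGas

open MeasureTheory ProbabilityTheory Filter Set
open scoped ENNReal NNReal Topology InnerProductSpace
open Literature.Probability.Process

variable {N : ℕ}

/-! ### The exit probability integrated over the box tends to zero -/

/-- The non-survival event is jointly measurable in (starting point, sample). [folklore] -/
theorem measurableSet_not_survives_prod (L : ℝ) (s : ℝ) :
    MeasurableSet {q : Config N × PathSpace N | q.2 ∈ survives L s q.1}ᶜ := by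
  have h : MeasurableSet {q : Config N × PathSpace N | ∀ r ∈ Icc (0 : ℝ) s,
      (fun (q : Config N × PathSpace N) (r : ℝ) => worldLine q.1 q.2 r.toNNReal) q r ∈ boxN N L} :=
    measurableSet_forall_mem_Icc (isOpen_boxN N L)
      (fun q : Config N × PathSpace N => continuous_worldLine_toNNReal q.1 q.2)
      (fun r => (measurable_worldLine_uncurry' r.toNNReal)) s
  exact h.compl

/-- `x ↦ P(τ_Λ^x ≤ s)` is measurable. [folklore] -/
theorem measurable_measure_not_survives (L : ℝ) (s : ℝ) :
    Measurable fun x : Config N => wienerPaths N (survives L s x)ᶜ :=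
  measurable_measure_prodMk_left (ν := wienerPaths N) (measurableSet_not_survives_prod (N := N) L s)

/-- For `x` in the open box the exit probability by time `s` tends to `0` as `s → 0`. [folklore] -/
theorem tendsto_measure_not_survives {L : ℝ} {x : Config N} (hx : x ∈ boxN N L) :
    Tendsto (fun s : ℝ≥0 => wienerPaths N (survives L s x)ᶜ) (𝓝 0) (𝓝 0) := by
  obtain ⟨r, hr, hball⟩ := Metric.isOpen_iff.1 (isOpen_boxN N L) x hx
  have hcb : Metric.closedBall x (r / 2) ⊆ boxN N L :=
    (Metric.closedBall_subset_ball (by linarith)).trans hball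
  have hr2 : 0 < r / 2 := by linarith
  have hbound : ∀ s : ℝ≥0, wienerPaths N (survives L s x)ᶜ ≤
      ∑ _i : Fin N, ∑ _k : Fin 3, preWienerMeasure {η | ∃ u ≤ s, r / 2 / Real.sqrt 6 ≤ |brownian u η|} :=
    fun s => measure_not_survives_le L s hr2 hcb
  have hlim : Tendsto (fun s : ℝ≥0 => ∑ _i : Fin N, ∑ _k : Fin 3,
      preWienerMeasure {η | ∃ u ≤ s, r / 2 / Real.sqrt 6 ≤ |brownian u η|}) (𝓝 0) (𝓝 0) := by
    have h1 := tendsto_tail_zero (a := r / 2 / Real.sqrt 6) (by positivity)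
    have : (0 : ℝ≥0∞) = ∑ _i : Fin N, ∑ _k : Fin 3, (0 : ℝ≥0∞) := by simp
    rw [this]
    exact tendsto_finsetSum _ fun i _ => tendsto_finsetSum _ fun k _ => h1
  exact tendsto_of_tendsto_of_tendsto_of_le_of_le tendsto_const_nhds hlim (fun s => bot_le) hbound

/-- **`∫_Λ P_x(τ_Λ ≤ s) dx → 0` as `s → 0`** (dominated convergence on the finite box). [folklore] -/
theorem tendsto_setLIntegral_not_survives (L : ℝ) :
    Tendsto (fun s : ℝ≥0 => ∫⁻ x in boxN N L, wienerPaths N (survives L s x)ᶜ) (𝓝 0) (𝓝 0) := by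
  have hfin : volume (boxN N L) < ⊤ := volume_boxN_lt_top N L
  have h := tendsto_lintegral_filter_of_dominated_convergence (μ := volume.restrict (boxN N L))
    (l := 𝓝 (0 : ℝ≥0)) (F := fun (s : ℝ≥0) (x : Config N) => wienerPaths N (survives L s x)ᶜ)
    (f := fun _ => 0) (fun _ => 1)
    (Eventually.of_forall fun s => measurable_measure_not_survives L s)
    (Eventually.of_forall fun s => Eventually.of_forall fun x => prob_le_one)
    (by rw [lintegral_const, Measure.restrict_apply_univ, one_mul]; exact hfin.ne)
    ((ae_restrict_iff' (measurableSet_boxN N L)).2 (Eventually.of_forall fun x hx =>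
      tendsto_measure_not_survives hx))
  simpa using h

/-! ### `∫₀ᵗ V ≤ (1 − w_t) + 𝟙{τ ≤ t} ∫₀ᵗ V + (∫₀ᵗ V)²` -/

/-- Real form: `a ≤ 1 − e^{−a} + a²` for `a ≥ 0`. [folklore] -/
theorem le_one_sub_exp_neg_add_sq {a : ℝ} (ha : 0 ≤ a) : a ≤ 1 - Real.exp (-a) + a ^ 2 := by
  have h1 : 1 - a ≤ Real.exp (-a) := by linarith [Real.add_one_le_exp (-a)]
  have h2 : Real.exp (-a) * (1 + a) ≤ 1 := by
    have h := Real.add_one_le_exp a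
    have hpos : 0 < Real.exp (-a) := Real.exp_pos _
    calc Real.exp (-a) * (1 + a) ≤ Real.exp (-a) * Real.exp a := by
          gcongr; linarith
      _ = 1 := by rw [← Real.exp_add]; simp
  nlinarith [mul_nonneg ha (by linarith : 0 ≤ Real.exp (-a) + a - 1), Real.exp_pos (-a)]

/-- Pointwise: `∫₀ᵗ V(B_s)ds ≤ (1 − w_t) + 𝟙{τ ≤ t} ∫₀ᵗ V + (∫₀ᵗ V)²` in `[0, ∞]`. [folklore] -/
theorem pathAction_le_one_sub_fkWeight_add (v : ℝ → ℝ≥0∞) (L t : ℝ) (X : Config N)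
    (ω : PathSpace N) :
    pathAction v t X ω ≤ (1 - fkWeight v L t X ω) +
      (survives L t X)ᶜ.indicator (1 : PathSpace N → ℝ≥0∞) ω * pathAction v t X ω +
        pathAction v t X ω ^ 2 := by
  by_cases hω : ω ∈ survives L t X
  · rw [indicator_of_notMem (notMem_compl_iff.2 hω), zero_mul, add_zero, fkWeight,
      indicator_of_mem hω, expNeg]
    split_ifs with htop
    · rw [htop]; simp
    · set a : ℝ := (pathAction v t X ω).toReal with ha
      have ha0 : 0 ≤ a := ENNReal.toReal_nonneg
      have hexp1 : Real.exp (-a) ≤ 1 := Real.exp_le_one_iff.2 (neg_nonpos.2 ha0)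
      have hA : pathAction v t X ω = ENNReal.ofReal a := (ENNReal.ofReal_toReal htop).symm
      rw [hA]
      have h1 : (1 : ℝ≥0∞) - ENNReal.ofReal (Real.exp (-a)) = ENNReal.ofReal (1 - Real.exp (-a)) := by
        rw [← ENNReal.ofReal_one, ← ENNReal.ofReal_sub _ (Real.exp_nonneg _)]
      have h1' : 0 ≤ 1 - Real.exp (-a) := by linarith
      rw [h1, ← ENNReal.ofReal_pow ha0, ← ENNReal.ofReal_add h1' (sq_nonneg _)]
      exact ENNReal.ofReal_le_ofReal (le_one_sub_exp_neg_add_sq ha0)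
  · rw [indicator_of_mem (mem_compl hω), Pi.one_apply, one_mul, fkWeight, indicator_of_notMem hω,
      tsub_zero]
    exact le_add_right le_add_self

/-! ### `⟨f, P_t f⟩ − ⟨f, T_t f⟩` exactly, for `f ≥ 0` -/

section Exact

variable {v : ℝ → ℝ≥0∞} {L : ℝ}

/-- `ofReal (1 − w) = 1 − w` for the weight `w ≤ 1`. [folklore] -/
theorem ofReal_one_sub_toReal_fkWeight (v : ℝ → ℝ≥0∞) (L t : ℝ) (X : Config N) (ω : PathSpace N) :
    ENNReal.ofReal (1 - (fkWeight v L t X ω).toReal) = 1 - fkWeight v L t X ω := by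
  rw [ENNReal.ofReal_sub _ ENNReal.toReal_nonneg, ENNReal.ofReal_one,
    ENNReal.ofReal_toReal ((fkWeight_le_one v L t X ω).trans_lt ENNReal.one_lt_top).ne]

/-- **`∫ f(x) E[f(x + √2 b_t)] dx − ∫_Λ f · T_t f = ∫ f(x) E_x[(1 − w_t) f(B_t)] dx` for `f ≥ 0`**
bounded measurable vanishing off the box (`t > 0`), the right side read in `[0, ∞]`.
[cite: ChungZhao1995, Prop 3.29] -/
theorem pairing_shift_sub_fkReal_eq (hv : Measurable v) (L : ℝ) (t : ℝ≥0)
    {f : Config N → ℝ} (hf : Measurable f) {M : ℝ} (hM : ∀ x, |f x| ≤ M) (hf0 : ∀ x, 0 ≤ f x)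
    (hzero : ∀ x, x ∉ boxN N L → f x = 0) :
    (∫ x, f x * ∫ ω, f (x + displacement t ω) ∂wienerPaths N) -
        ∫ x in boxN N L, f x * fkReal v L t f x =
      (∫⁻ x, ‖f x‖ₑ * ∫⁻ ω, (1 - fkWeight v L t x ω) * ‖f (x + displacement t ω)‖ₑ
        ∂wienerPaths N).toReal := by
  have hM0 : 0 ≤ M := (abs_nonneg _).trans (hM 0)
  have hw01 : ∀ (x : Config N) (ω : PathSpace N),
      0 ≤ (fkWeight v L t x ω).toReal ∧ (fkWeight v L t x ω).toReal ≤ 1 := fun x ω =>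
    ⟨ENNReal.toReal_nonneg, ENNReal.toReal_le_of_le_ofReal zero_le_one
      (by rw [ENNReal.ofReal_one]; exact fkWeight_le_one v L t x ω)⟩
  have hshift : Measurable fun p : Config N × PathSpace N => f (p.1 + displacement t p.2) :=
    hf.comp (measurable_fst.add ((measurable_displacement t).comp measurable_snd))
  have hwm : Measurable fun p : Config N × PathSpace N => (fkWeight v L t p.1 p.2).toReal :=
    (measurable_fkWeight_uncurry hv L t).ennreal_toReal
  have hP_meas : Measurable fun x => ∫ ω, f (x + displacement t ω) ∂wienerPaths N :=
    (hshift.stronglyMeasurable.integral_prod_right' (ν := wienerPaths N)).measurable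
  have hP_bd : ∀ x, |∫ ω, f (x + displacement t ω) ∂wienerPaths N| ≤ M := fun x => by
    have h := norm_integral_le_of_norm_le_const (μ := wienerPaths N)
      (f := fun ω => f (x + displacement t ω)) (C := M)
      (Eventually.of_forall fun ω => by rw [Real.norm_eq_abs]; exact hM _)
    rwa [probReal_univ, mul_one, Real.norm_eq_abs] at h
  have hT_eq : ∀ x, fkReal v L t f x =
      ∫ ω, (fkWeight v L t x ω).toReal * f (x + displacement t ω) ∂wienerPaths N := fun x => by
    simp only [fkReal, Real.toNNReal_coe]
    rfl
  have hT_bd : ∀ x, |fkReal v L t f x| ≤ M := fun x => by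
    rw [hT_eq x]
    have h := norm_integral_le_of_norm_le_const (μ := wienerPaths N)
      (f := fun ω => (fkWeight v L t x ω).toReal * f (x + displacement t ω)) (C := M)
      (Eventually.of_forall fun ω => by
        rw [Real.norm_eq_abs, abs_mul, abs_of_nonneg (hw01 x ω).1]
        calc (fkWeight v L t x ω).toReal * |f (x + displacement t ω)| ≤ 1 * M :=
              mul_le_mul (hw01 x ω).2 (hM _) (abs_nonneg _) zero_le_one
          _ = M := one_mul M)
    rwa [probReal_univ, mul_one, Real.norm_eq_abs] at h
  haveI : IsFiniteMeasure (volume.restrict (boxN N L) : Measure (Config N)) :=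
    ⟨by rw [Measure.restrict_apply_univ]; exact volume_boxN_lt_top N L⟩
  have hint1 : Integrable (fun x => f x * ∫ ω, f (x + displacement t ω) ∂wienerPaths N)
      (volume.restrict (boxN N L)) :=
    (integrable_const (M * M)).mono' (hf.mul hP_meas).aestronglyMeasurable
      (Eventually.of_forall fun x => by
        rw [Real.norm_eq_abs, abs_mul]; exact mul_le_mul (hM x) (hP_bd x) (abs_nonneg _) hM0)
  have hint2 : Integrable (fun x => f x * fkReal v L t f x) (volume.restrict (boxN N L)) :=
    (integrable_const (M * M)).mono' (hf.mul (measurable_fkReal hv L t hf)).aestronglyMeasurable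
      (Eventually.of_forall fun x => by
        rw [Real.norm_eq_abs, abs_mul]; exact mul_le_mul (hM x) (hT_bd x) (abs_nonneg _) hM0)
  have hGint : ∀ x, Integrable (fun ω => (1 - (fkWeight v L t x ω).toReal) *
      f (x + displacement t ω)) (wienerPaths N) := fun x =>
    (integrable_const M).mono' (((measurable_const.sub ((measurable_fkWeight hv L t x).ennreal_toReal)).mul
      (hf.comp ((measurable_displacement t).const_add x))).aestronglyMeasurable)
      (Eventually.of_forall fun ω => by
        rw [Real.norm_eq_abs, abs_mul, abs_of_nonneg (sub_nonneg.2 (hw01 x ω).2),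
          abs_of_nonneg (hf0 _)]
        calc (1 - (fkWeight v L t x ω).toReal) * f (x + displacement t ω) ≤ 1 * M :=
              mul_le_mul (by linarith [(hw01 x ω).1]) ((le_abs_self _).trans (hM _)) (hf0 _)
                zero_le_one
          _ = M := one_mul M)
  have hdiff : ∀ x, f x * (∫ ω, f (x + displacement t ω) ∂wienerPaths N) - f x * fkReal v L t f x =
      f x * ∫ ω, (1 - (fkWeight v L t x ω).toReal) * f (x + displacement t ω) ∂wienerPaths N := by
    intro x
    have hi1 : Integrable (fun ω => f (x + displacement t ω)) (wienerPaths N) :=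
      (integrable_const M).mono' (hf.comp ((measurable_displacement t).const_add x)).aestronglyMeasurable
        (Eventually.of_forall fun ω => by rw [Real.norm_eq_abs]; exact hM _)
    have hi2 : Integrable (fun ω => (fkWeight v L t x ω).toReal * f (x + displacement t ω))
        (wienerPaths N) :=
      (integrable_const M).mono' (((measurable_fkWeight hv L t x).ennreal_toReal).mul
        (hf.comp ((measurable_displacement t).const_add x))).aestronglyMeasurable
        (Eventually.of_forall fun ω => by
          rw [Real.norm_eq_abs, abs_mul, abs_of_nonneg (hw01 x ω).1]
          calc (fkWeight v L t x ω).toReal * |f (x + displacement t ω)| ≤ 1 * M :=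
                mul_le_mul (hw01 x ω).2 (hM _) (abs_nonneg _) zero_le_one
            _ = M := one_mul M)
    rw [hT_eq x, ← mul_sub, ← integral_sub hi1 hi2]
    congr 1
    refine integral_congr_ae (Eventually.of_forall fun ω => ?_)
    ring
  -- the nonnegative integrand `g`
  have hGm : Measurable fun p : Config N × PathSpace N =>
      (1 - (fkWeight v L t p.1 p.2).toReal) * f (p.1 + displacement t p.2) :=
    (measurable_const.sub hwm).mul hshift
  have hg_meas : Measurable fun x => f x *
      ∫ ω, (1 - (fkWeight v L t x ω).toReal) * f (x + displacement t ω) ∂wienerPaths N :=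
    hf.mul (hGm.stronglyMeasurable.integral_prod_right' (ν := wienerPaths N)).measurable
  have hin0 : ∀ x, 0 ≤ ∫ ω, (1 - (fkWeight v L t x ω).toReal) * f (x + displacement t ω)
      ∂wienerPaths N := fun x =>
    integral_nonneg fun ω => mul_nonneg (sub_nonneg.2 (hw01 x ω).2) (hf0 _)
  have hg0 : ∀ x, 0 ≤ f x *
      ∫ ω, (1 - (fkWeight v L t x ω).toReal) * f (x + displacement t ω) ∂wienerPaths N :=
    fun x => mul_nonneg (hf0 x) (hin0 x)
  rw [← setIntegral_eq_integral_of_forall_compl_eq_zero (s := boxN N L) (fun x hx => by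
    rw [hzero x hx, zero_mul]), ← integral_sub hint1 hint2]
  simp_rw [hdiff]
  rw [integral_eq_lintegral_of_nonneg_ae (Eventually.of_forall hg0) hg_meas.aestronglyMeasurable]
  congr 1
  rw [setLIntegral_eq_of_support_subset (fun x hx => by
    by_contra h
    simp only [Function.mem_support, ne_eq] at hx
    exact hx (by rw [hzero x h, zero_mul, ENNReal.ofReal_zero]))]
  refine lintegral_congr fun x => ?_
  rw [ENNReal.ofReal_mul (hf0 x), ← Real.enorm_eq_ofReal (hf0 x),
    ofReal_integral_eq_lintegral_ofReal (hGint x) (Eventually.of_forall fun ω =>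
      mul_nonneg (sub_nonneg.2 (hw01 x ω).2) (hf0 _))]
  congr 1
  refine lintegral_congr fun ω => ?_
  rw [ENNReal.ofReal_mul (sub_nonneg.2 (hw01 x ω).2), ofReal_one_sub_toReal_fkWeight,
    ← Real.enorm_eq_ofReal (hf0 _)]

end Exact

/-! ### The small-time bound on `sqIncr t φ₀ / (2t)` -/

section Upper

variable {v : ℝ → ℝ≥0∞} {C : ℝ≥0} {L : ℝ} {e : Lp ℝ 2 (volume.restrict (boxN N L))}
  {φ : Config N → ℝ}

/-- **The interaction term is dominated by `⟨φ, (P_t − T_t)φ⟩` up to killing and second-order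
corrections** (for `φ ≥ 0` bounded measurable vanishing off the box):
`J_t ≤ D_t + Q_t + K''_t` with `D_t = ∫ φ E[(1−w_t) φ(B_t)]`, `Q_t = ∫ φ E[(∫₀ᵗV)² φ(B_t)]`,
`K''_t = ∫ φ E[𝟙{τ ≤ t} (∫₀ᵗV) φ(B_t)]`. [folklore] -/
theorem interactionTerm_le_three (hv : Measurable v) (L : ℝ) (t : ℝ≥0) {f : Config N → ℝ}
    (hf : Measurable f) :
    (∫⁻ x, ‖f x‖ₑ * ∫⁻ ω, pathAction v t x ω * ‖f (worldLine x ω t)‖ₑ ∂wienerPaths N) ≤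
      (∫⁻ x, ‖f x‖ₑ * ∫⁻ ω, (1 - fkWeight v L t x ω) * ‖f (x + displacement t ω)‖ₑ ∂wienerPaths N) +
      (∫⁻ x, ‖f x‖ₑ * ∫⁻ ω, pathAction v t x ω ^ 2 * ‖f (x + displacement t ω)‖ₑ ∂wienerPaths N) +
      ∫⁻ x, ‖f x‖ₑ * ∫⁻ ω, (survives L t x)ᶜ.indicator (1 : PathSpace N → ℝ≥0∞) ω *
        pathAction v t x ω * ‖f (x + displacement t ω)‖ₑ ∂wienerPaths N := by
  have hshift : Measurable fun p : Config N × PathSpace N => f (p.1 + displacement t p.2) :=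
    hf.comp (measurable_fst.add ((measurable_displacement t).comp measurable_snd))
  have hFm : ∀ x, Measurable fun ω : PathSpace N => ‖f (x + displacement t ω)‖ₑ := fun x =>
    (hf.comp ((measurable_displacement t).const_add x)).enorm
  have hD1 : Measurable fun p : Config N × PathSpace N =>
      (1 - fkWeight v L t p.1 p.2) * ‖f (p.1 + displacement t p.2)‖ₑ :=
    (measurable_const.sub (measurable_fkWeight_uncurry hv L t)).mul hshift.enorm
  have hQ1 : Measurable fun p : Config N × PathSpace N =>
      pathAction v t p.1 p.2 ^ 2 * ‖f (p.1 + displacement t p.2)‖ₑ :=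
    ((measurable_pathAction_uncurry hv t).pow_const 2).mul hshift.enorm
  -- pointwise in `x`
  have hDx : ∀ x, Measurable fun ω : PathSpace N =>
      (1 - fkWeight v L t x ω) * ‖f (x + displacement t ω)‖ₑ := fun x =>
    (measurable_const.sub (measurable_fkWeight hv L t x)).mul (hFm x)
  have hQx : ∀ x, Measurable fun ω : PathSpace N =>
      pathAction v t x ω ^ 2 * ‖f (x + displacement t ω)‖ₑ := fun x =>
    ((measurable_pathAction hv t x).pow_const 2).mul (hFm x)
  have hx : ∀ x, ‖f x‖ₑ * ∫⁻ ω, pathAction v t x ω * ‖f (worldLine x ω t)‖ₑ ∂wienerPaths N ≤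
      ‖f x‖ₑ * (∫⁻ ω, (1 - fkWeight v L t x ω) * ‖f (x + displacement t ω)‖ₑ ∂wienerPaths N) +
      ‖f x‖ₑ * (∫⁻ ω, pathAction v t x ω ^ 2 * ‖f (x + displacement t ω)‖ₑ ∂wienerPaths N) +
      ‖f x‖ₑ * ∫⁻ ω, (survives L t x)ᶜ.indicator (1 : PathSpace N → ℝ≥0∞) ω *
        pathAction v t x ω * ‖f (x + displacement t ω)‖ₑ ∂wienerPaths N := by
    intro x
    have hsum : ∫⁻ ω, ((1 - fkWeight v L t x ω) * ‖f (x + displacement t ω)‖ₑ +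
        pathAction v t x ω ^ 2 * ‖f (x + displacement t ω)‖ₑ +
        (survives L t x)ᶜ.indicator (1 : PathSpace N → ℝ≥0∞) ω *
          pathAction v t x ω * ‖f (x + displacement t ω)‖ₑ) ∂wienerPaths N =
        (∫⁻ ω, (1 - fkWeight v L t x ω) * ‖f (x + displacement t ω)‖ₑ ∂wienerPaths N) +
        (∫⁻ ω, pathAction v t x ω ^ 2 * ‖f (x + displacement t ω)‖ₑ ∂wienerPaths N) +
        ∫⁻ ω, (survives L t x)ᶜ.indicator (1 : PathSpace N → ℝ≥0∞) ω *
          pathAction v t x ω * ‖f (x + displacement t ω)‖ₑ ∂wienerPaths N := by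
      rw [lintegral_add_left (f := fun ω => (1 - fkWeight v L t x ω) * ‖f (x + displacement t ω)‖ₑ +
        pathAction v t x ω ^ 2 * ‖f (x + displacement t ω)‖ₑ) ((hDx x).add (hQx x)),
        lintegral_add_left (f := fun ω => (1 - fkWeight v L t x ω) * ‖f (x + displacement t ω)‖ₑ)
        (hDx x)]
    calc ‖f x‖ₑ * ∫⁻ ω, pathAction v t x ω * ‖f (worldLine x ω t)‖ₑ ∂wienerPaths N
        ≤ ‖f x‖ₑ * ∫⁻ ω, ((1 - fkWeight v L t x ω) * ‖f (x + displacement t ω)‖ₑ +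
            pathAction v t x ω ^ 2 * ‖f (x + displacement t ω)‖ₑ +
            (survives L t x)ᶜ.indicator (1 : PathSpace N → ℝ≥0∞) ω *
              pathAction v t x ω * ‖f (x + displacement t ω)‖ₑ) ∂wienerPaths N := by
          refine mul_le_mul' le_rfl (lintegral_mono fun ω => ?_)
          calc pathAction v t x ω * ‖f (worldLine x ω t)‖ₑ
              ≤ ((1 - fkWeight v L t x ω) + (survives L t x)ᶜ.indicator (1 : PathSpace N → ℝ≥0∞) ω *
                  pathAction v t x ω + pathAction v t x ω ^ 2) * ‖f (x + displacement t ω)‖ₑ :=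
                mul_le_mul' (pathAction_le_one_sub_fkWeight_add v L t x ω) le_rfl
            _ = _ := by ring
      _ = _ := by rw [hsum]; ring
  have ha : Measurable fun x => ‖f x‖ₑ *
      ∫⁻ ω, (1 - fkWeight v L t x ω) * ‖f (x + displacement t ω)‖ₑ ∂wienerPaths N :=
    hf.enorm.mul hD1.lintegral_prod_right'
  have hb : Measurable fun x => ‖f x‖ₑ *
      ∫⁻ ω, pathAction v t x ω ^ 2 * ‖f (x + displacement t ω)‖ₑ ∂wienerPaths N :=
    hf.enorm.mul hQ1.lintegral_prod_right'
  have hsumx : ∫⁻ x, (‖f x‖ₑ * (∫⁻ ω, (1 - fkWeight v L t x ω) * ‖f (x + displacement t ω)‖ₑ ∂wienerPaths N) +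
      ‖f x‖ₑ * (∫⁻ ω, pathAction v t x ω ^ 2 * ‖f (x + displacement t ω)‖ₑ ∂wienerPaths N) +
      ‖f x‖ₑ * ∫⁻ ω, (survives L t x)ᶜ.indicator (1 : PathSpace N → ℝ≥0∞) ω *
        pathAction v t x ω * ‖f (x + displacement t ω)‖ₑ ∂wienerPaths N) =
      (∫⁻ x, ‖f x‖ₑ * ∫⁻ ω, (1 - fkWeight v L t x ω) * ‖f (x + displacement t ω)‖ₑ ∂wienerPaths N) +
      (∫⁻ x, ‖f x‖ₑ * ∫⁻ ω, pathAction v t x ω ^ 2 * ‖f (x + displacement t ω)‖ₑ ∂wienerPaths N) +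
      ∫⁻ x, ‖f x‖ₑ * ∫⁻ ω, (survives L t x)ᶜ.indicator (1 : PathSpace N → ℝ≥0∞) ω *
        pathAction v t x ω * ‖f (x + displacement t ω)‖ₑ ∂wienerPaths N := by
    rw [lintegral_add_left (f := fun x =>
      ‖f x‖ₑ * (∫⁻ ω, (1 - fkWeight v L t x ω) * ‖f (x + displacement t ω)‖ₑ ∂wienerPaths N) +
      ‖f x‖ₑ * (∫⁻ ω, pathAction v t x ω ^ 2 * ‖f (x + displacement t ω)‖ₑ ∂wienerPaths N)) (ha.add hb),
      lintegral_add_left (f := fun x =>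
      ‖f x‖ₑ * (∫⁻ ω, (1 - fkWeight v L t x ω) * ‖f (x + displacement t ω)‖ₑ ∂wienerPaths N)) ha]
  rw [← hsumx]
  exact lintegral_mono hx

set_option maxHeartbeats 800000 in
/-- **The small-time free form of the ground state**: for the continuous ground-state function
`φ₀` (Perron–Frobenius eigenvector of `T_1`, `‖φ₀‖₂ = 1`, `T_tφ₀ = μ₀^tφ₀`) and `ε > 0`,
eventually as `t → 0+`:  `sqIncr t φ₀ / (2t) ≤ −log μ₀ − ∫ V φ₀² + ε`.  This is the hypothesis
`hev` of `lintegral_realKinetic_trialFn_le` with `K' = λ₀ − ∫ V φ₀² + ε`.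
[cite: ChungZhao1995, Prop 3.29 (81)] -/
theorem eventually_sqIncr_div_le (hv : Measurable v) (hC : ∀ r, v r ≤ C)
    (hT1 : fkL2 (N := N) v L 1 ≠ 0) (he1 : ‖e‖ = 1) (he0 : 0 ≤ e)
    (hTe : fkL2 v L 1 e = ‖fkL2 (N := N) v L 1‖ • e)
    (hsimple : ∀ f, fkL2 v L 1 f = ‖fkL2 (N := N) v L 1‖ • f → ∃ c : ℝ, f = c • e)
    (hφ : φ = fun X => ‖fkL2 (N := N) v L 1‖⁻¹ *
      fkReal v L 1 (fun Y => max ((e : Config N → ℝ) Y) 0) X)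
    {ε : ℝ} (hε : 0 < ε) :
    ∀ᶠ t : ℝ≥0 in 𝓝[>] 0, (ENNReal.ofReal (2 * t))⁻¹ * sqIncr t φ ≤
      ENNReal.ofReal (-Real.log ‖fkL2 (N := N) v L 1‖ -
        (∫⁻ x, interaction v x * ‖φ x‖ₑ ^ 2).toReal + ε) := by
  set μ₀ : ℝ := ‖fkL2 (N := N) v L 1‖ with hμ₀def
  have hμ₀ : 0 < μ₀ := norm_pos_iff.2 hT1
  have hμ₀1 : μ₀ ≤ 1 := norm_fkL2_le_one v L 1
  set lam : ℝ := -Real.log μ₀ with hlam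
  -- `φ`
  have hmeas : Measurable φ := measurable_gs hv hφ
  have h0 : ∀ x, 0 ≤ φ x := gs_nonneg hμ₀.le hφ
  have hzero : ∀ x, x ∉ boxN N L → φ x = 0 := fun x hx => gs_of_notMem hφ hx
  have hcont : Continuous φ := continuous_gs hv hC hμ₀ hφ
  have hsupp : HasCompactSupport φ :=
    HasCompactSupport.intro' (isBounded_boxN N L).isCompact_closure isClosed_closure
      fun x hx => hzero x fun h => hx (subset_closure h)
  obtain ⟨M, hM⟩ := gs_bounded hφ
  have hM0 : 0 ≤ M := (abs_nonneg _).trans (hM 0)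
  have hmem : MemLp φ 2 volume := hcont.memLp_of_hasCompactSupport hsupp
  -- `∫ φ² = 1`
  have hsq1 : ∫⁻ x, ENNReal.ofReal (φ x ^ 2) = 1 := by
    rw [← lintegral_gs_sq hv he1 he0 hμ₀ hTe hφ]
    exact lintegral_congr fun x => (ENNReal.ofReal_pow (h0 x) 2)
  have hint2 : Integrable (fun x => φ x ^ 2) volume := by
    have : (fun x => φ x ^ 2) = fun x => φ x * φ x := funext fun x => sq (φ x)
    rw [this]; exact (hcont.mul hcont).integrable_of_hasCompactSupport hsupp.mul_right
  have hn2 : ∫ x, φ x ^ 2 = 1 := by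
    rw [← toReal_lintegral_sq hint2, hsq1, ENNReal.toReal_one]
  have hn2box : ∫ x in boxN N L, φ x ^ 2 = 1 := by
    rw [← hn2]
    exact setIntegral_eq_integral_of_forall_compl_eq_zero fun x hx => by rw [hzero x hx]; ring
  -- `I = ∫ V φ²` is finite
  set I : ℝ≥0∞ := ∫⁻ x, interaction v x * ‖φ x‖ₑ ^ 2 with hIdef
  have hI_top : I ≠ ⊤ := by
    have hb : ∀ x, interaction v x * ‖φ x‖ₑ ^ 2 ≤ (boxN N L).indicator
        (fun _ => (N * N : ℕ) * C * ENNReal.ofReal (M ^ 2)) x := by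
      intro x
      by_cases hx : x ∈ boxN N L
      · rw [indicator_of_mem hx]
        refine mul_le_mul' (interaction_le_of_le hC x) ?_
        rw [Real.enorm_eq_ofReal_abs, ← ENNReal.ofReal_pow (abs_nonneg _), sq_abs]
        exact ENNReal.ofReal_le_ofReal (by nlinarith [abs_le.1 (hM x), hM0])
      · rw [indicator_of_notMem hx, hzero x hx]; simp
    refine ne_top_of_le_ne_top ?_ (lintegral_mono hb)
    rw [lintegral_indicator (measurableSet_boxN N L), setLIntegral_const]
    exact ENNReal.mul_ne_top (ENNReal.mul_ne_top (ENNReal.mul_ne_top (ENNReal.natCast_ne_top _)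
      ENNReal.coe_ne_top) ENNReal.ofReal_ne_top) (volume_boxN_lt_top N L).ne
  -- constants
  have hL1 : ∫⁻ x, ‖φ x‖ₑ ≤ ENNReal.ofReal M * volume (boxN N L) := by
    calc ∫⁻ x, ‖φ x‖ₑ ≤ ∫⁻ x, (boxN N L).indicator (fun _ => ENNReal.ofReal M) x := by
          refine lintegral_mono fun x => ?_
          by_cases hx : x ∈ boxN N L
          · rw [indicator_of_mem hx, Real.enorm_eq_ofReal_abs]; exact ENNReal.ofReal_le_ofReal (hM x)
          · rw [indicator_of_notMem hx, hzero x hx]; simp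
      _ = _ := by rw [lintegral_indicator (measurableSet_boxN N L), setLIntegral_const]
  have hL1top : ∫⁻ x, ‖φ x‖ₑ ≠ ⊤ :=
    ne_top_of_le_ne_top (ENNReal.mul_ne_top ENNReal.ofReal_ne_top (volume_boxN_lt_top N L).ne) hL1
  have hFle : ∀ (t : ℝ≥0) x ω, ‖φ (x + displacement t ω)‖ₑ ≤ ENNReal.ofReal M := fun t x ω => by
    rw [Real.enorm_eq_ofReal_abs]; exact ENNReal.ofReal_le_ofReal (hM _)
  set cV : ℝ≥0∞ := (N * N : ℕ) * C with hcV
  have hcV_top : cV ≠ ⊤ := ENNReal.mul_ne_top (ENNReal.natCast_ne_top _) ENNReal.coe_ne_top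
  have hA : ∀ (t : ℝ≥0) (x : Config N) (ω : PathSpace N),
      pathAction v t x ω ≤ cV * ENNReal.ofReal t := fun t x ω => pathAction_le_of_le hC t x ω
  -- the four quantities
  set D : ℝ≥0 → ℝ≥0∞ := fun t => ∫⁻ x, ‖φ x‖ₑ * ∫⁻ ω, (1 - fkWeight v L t x ω) *
    ‖φ (x + displacement t ω)‖ₑ ∂wienerPaths N with hDdef
  set J : ℝ≥0 → ℝ≥0∞ := fun t => ∫⁻ x, ‖φ x‖ₑ * ∫⁻ ω, pathAction v t x ω *
    ‖φ (worldLine x ω t)‖ₑ ∂wienerPaths N with hJdef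
  set Q : ℝ≥0 → ℝ≥0∞ := fun t => ∫⁻ x, ‖φ x‖ₑ * ∫⁻ ω, pathAction v t x ω ^ 2 *
    ‖φ (x + displacement t ω)‖ₑ ∂wienerPaths N with hQdef
  set K : ℝ≥0 → ℝ≥0∞ := fun t => ∫⁻ x, ‖φ x‖ₑ * ∫⁻ ω, (survives L t x)ᶜ.indicator
    (1 : PathSpace N → ℝ≥0∞) ω * pathAction v t x ω * ‖φ (x + displacement t ω)‖ₑ ∂wienerPaths N
    with hKdef
  set S : ℝ≥0 → ℝ≥0∞ := fun t => ∫⁻ x in boxN N L, wienerPaths N (survives L t x)ᶜ with hSdef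
  -- bounds on `Q`, `K`
  have hQle : ∀ t : ℝ≥0, Q t ≤ (cV * ENNReal.ofReal t) ^ 2 * ENNReal.ofReal M *
      (ENNReal.ofReal M * volume (boxN N L)) := by
    intro t
    calc Q t ≤ ∫⁻ x, ‖φ x‖ₑ * ∫⁻ _ω, (cV * ENNReal.ofReal t) ^ 2 * ENNReal.ofReal M ∂wienerPaths N := by
          refine lintegral_mono fun x => mul_le_mul' le_rfl (lintegral_mono fun ω => ?_)
          exact mul_le_mul' (pow_le_pow_left' (hA t x ω) 2) (hFle t x ω)
      _ = (cV * ENNReal.ofReal t) ^ 2 * ENNReal.ofReal M * ∫⁻ x, ‖φ x‖ₑ := by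
          simp only [lintegral_const, measure_univ, mul_one]
          rw [← lintegral_const_mul' _ _ (ENNReal.mul_ne_top (ENNReal.pow_ne_top
            (ENNReal.mul_ne_top hcV_top ENNReal.ofReal_ne_top)) ENNReal.ofReal_ne_top)]
          exact lintegral_congr fun x => by ring
      _ ≤ _ := mul_le_mul' le_rfl hL1
  have hKle : ∀ t : ℝ≥0, K t ≤ ENNReal.ofReal M * (cV * ENNReal.ofReal t * ENNReal.ofReal M) * S t := by
    intro t
    have hin : ∀ x, ∫⁻ ω, (survives L t x)ᶜ.indicator (1 : PathSpace N → ℝ≥0∞) ω *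
        pathAction v t x ω * ‖φ (x + displacement t ω)‖ₑ ∂wienerPaths N ≤
        (cV * ENNReal.ofReal t * ENNReal.ofReal M) * wienerPaths N (survives L t x)ᶜ := by
      intro x
      calc ∫⁻ ω, (survives L t x)ᶜ.indicator (1 : PathSpace N → ℝ≥0∞) ω *
            pathAction v t x ω * ‖φ (x + displacement t ω)‖ₑ ∂wienerPaths N
          ≤ ∫⁻ ω, (survives L t x)ᶜ.indicator (fun _ => cV * ENNReal.ofReal t * ENNReal.ofReal M) ω
              ∂wienerPaths N := by
            refine lintegral_mono fun ω => ?_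
            by_cases hω : ω ∈ (survives L (t : ℝ) x)ᶜ
            · rw [indicator_of_mem hω, indicator_of_mem hω, Pi.one_apply, one_mul]
              exact mul_le_mul' (hA t x ω) (hFle t x ω)
            · rw [indicator_of_notMem hω, indicator_of_notMem hω]; simp
        _ = _ := lintegral_indicator_const (measurableSet_survives L t x).compl _
    calc K t ≤ ∫⁻ x, ‖φ x‖ₑ * ((cV * ENNReal.ofReal t * ENNReal.ofReal M) *
          wienerPaths N (survives L t x)ᶜ) := lintegral_mono fun x => mul_le_mul' le_rfl (hin x)
      _ ≤ ∫⁻ x, (boxN N L).indicator (fun x => ENNReal.ofReal M *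
          ((cV * ENNReal.ofReal t * ENNReal.ofReal M) * wienerPaths N (survives L t x)ᶜ)) x := by
          refine lintegral_mono fun x => ?_
          by_cases hx : x ∈ boxN N L
          · rw [indicator_of_mem hx]
            refine mul_le_mul' ?_ le_rfl
            rw [Real.enorm_eq_ofReal_abs]; exact ENNReal.ofReal_le_ofReal (hM x)
          · rw [indicator_of_notMem hx, hzero x hx]; simp
      _ = _ := by
          rw [lintegral_indicator (measurableSet_boxN N L), hSdef]
          simp only
          rw [← lintegral_const_mul' _ _ (ENNReal.mul_ne_top ENNReal.ofReal_ne_top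
            (ENNReal.mul_ne_top (ENNReal.mul_ne_top hcV_top ENNReal.ofReal_ne_top)
              ENNReal.ofReal_ne_top))]
          exact lintegral_congr fun x => by ring
  -- finiteness
  have hSle : ∀ t : ℝ≥0, S t ≤ volume (boxN N L) := fun t => by
    calc S t ≤ ∫⁻ _x in boxN N L, 1 := lintegral_mono fun x => prob_le_one
      _ = volume (boxN N L) := by rw [setLIntegral_const, one_mul]
  have hS_top : ∀ t : ℝ≥0, S t ≠ ⊤ := fun t =>
    ne_top_of_le_ne_top (volume_boxN_lt_top N L).ne (hSle t)
  have hK_top : ∀ t : ℝ≥0, K t ≠ ⊤ := fun t => ne_top_of_le_ne_top (ENNReal.mul_ne_top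
    (ENNReal.mul_ne_top ENNReal.ofReal_ne_top (ENNReal.mul_ne_top (ENNReal.mul_ne_top hcV_top
      ENNReal.ofReal_ne_top) ENNReal.ofReal_ne_top)) (hS_top t)) (hKle t)
  have hQ_top : ∀ t : ℝ≥0, Q t ≠ ⊤ := fun t => ne_top_of_le_ne_top (ENNReal.mul_ne_top
    (ENNReal.mul_ne_top (ENNReal.pow_ne_top (ENNReal.mul_ne_top hcV_top ENNReal.ofReal_ne_top))
      ENNReal.ofReal_ne_top) (ENNReal.mul_ne_top ENNReal.ofReal_ne_top (volume_boxN_lt_top N L).ne))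
    (hQle t)
  have hD_top : ∀ t : ℝ≥0, D t ≠ ⊤ := by
    intro t
    refine ne_top_of_le_ne_top (b := ENNReal.ofReal M * ∫⁻ x, ‖φ x‖ₑ)
      (ENNReal.mul_ne_top ENNReal.ofReal_ne_top hL1top) ?_
    calc D t ≤ ∫⁻ x, ‖φ x‖ₑ * ∫⁻ _ω, ENNReal.ofReal M ∂wienerPaths N := by
          refine lintegral_mono fun x => mul_le_mul' le_rfl (lintegral_mono fun ω => ?_)
          calc (1 - fkWeight v L t x ω) * ‖φ (x + displacement t ω)‖ₑ ≤ 1 * ENNReal.ofReal M :=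
                mul_le_mul' tsub_le_self (hFle t x ω)
            _ = ENNReal.ofReal M := one_mul _
      _ = ENNReal.ofReal M * ∫⁻ x, ‖φ x‖ₑ := by
          simp only [lintegral_const, measure_univ, mul_one]
          rw [← lintegral_const_mul' _ _ ENNReal.ofReal_ne_top]
          exact lintegral_congr fun x => mul_comm _ _
  have hJ_top : ∀ t : ℝ≥0, J t ≠ ⊤ := fun t =>
    ne_top_of_le_ne_top (ENNReal.add_ne_top.2 ⟨ENNReal.add_ne_top.2 ⟨hD_top t, hQ_top t⟩, hK_top t⟩)
      (interactionTerm_le_three hv L t hmeas)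
  have hsq_top : ∀ t : ℝ≥0, sqIncr t φ ≠ ⊤ := fun t =>
    (sqIncr_lt_top hmeas (by rw [hsq1]; exact ENNReal.one_ne_top) t).ne
  -- the real inequality at each `t > 0`
  have hreal : ∀ t : ℝ≥0, 0 < t → (sqIncr t φ).toReal / (2 * t) ≤
      lam - ((J t) / (t : ℝ≥0∞)).toReal + (ENNReal.ofReal M * (cV * ENNReal.ofReal M)).toReal *
        (S t).toReal + ((cV ^ 2 * ENNReal.ofReal M * (ENNReal.ofReal M * volume (boxN N L))).toReal) * t := by
    intro t ht
    have ht' : (0 : ℝ) < t := ht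
    -- (i) `⟨φ, T_t φ⟩ = μ₀^t`
    have hTφ : ∫ x in boxN N L, φ x * fkReal v L t φ x = μ₀ ^ (t : ℝ) := by
      have : ∀ x, φ x * fkReal v L t φ x = μ₀ ^ (t : ℝ) * φ x ^ 2 := fun x => by
        rw [fkReal_gs hv hT1 he1 he0 hTe hsimple hφ ht' x]; ring
      simp_rw [this]
      rw [integral_const_mul, hn2box, mul_one]
    -- (ii) square identity and (iii) exact difference
    have hP := integral_mul_integral_shift_eq hmeas hmem t
    have hDiff := pairing_shift_sub_fkReal_eq hv L t hmeas hM h0 hzero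
    have hkey : (sqIncr t φ).toReal / 2 + (D t).toReal = 1 - μ₀ ^ (t : ℝ) := by
      have h1 : (D t).toReal = (1 - (sqIncr t φ).toReal / 2) - μ₀ ^ (t : ℝ) := by
        rw [hDdef]; simp only; rw [← hDiff, hP, hTφ, hn2]
      linarith
    -- (iv) `1 - μ₀^t ≤ λ₀ t`
    have hexp : 1 - μ₀ ^ (t : ℝ) ≤ lam * t := by
      rw [Real.rpow_def_of_pos hμ₀, hlam]
      have := Real.add_one_le_exp (Real.log μ₀ * t)
      nlinarith
    -- (v) `J ≤ D + Q + K` in reals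
    have hJle : (J t).toReal ≤ (D t).toReal + (Q t).toReal + (K t).toReal := by
      have h := interactionTerm_le_three hv L t hmeas (N := N)
      have h' := ENNReal.toReal_mono (ENNReal.add_ne_top.2 ⟨ENNReal.add_ne_top.2
        ⟨hD_top t, hQ_top t⟩, hK_top t⟩) h
      rwa [ENNReal.toReal_add (ENNReal.add_ne_top.2 ⟨hD_top t, hQ_top t⟩) (hK_top t),
        ENNReal.toReal_add (hD_top t) (hQ_top t)] at h'
    -- bounds in reals
    have hKr : (K t).toReal ≤ (ENNReal.ofReal M * (cV * ENNReal.ofReal M)).toReal * (S t).toReal * t := by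
      have h := ENNReal.toReal_mono (ENNReal.mul_ne_top (ENNReal.mul_ne_top ENNReal.ofReal_ne_top
        (ENNReal.mul_ne_top (ENNReal.mul_ne_top hcV_top ENNReal.ofReal_ne_top) ENNReal.ofReal_ne_top))
        (hS_top t)) (hKle t)
      rw [ENNReal.toReal_mul, ENNReal.toReal_mul, ENNReal.toReal_mul, ENNReal.toReal_mul,
        ENNReal.toReal_ofReal ht'.le] at h
      rw [ENNReal.toReal_mul, ENNReal.toReal_mul]
      calc (K t).toReal ≤ _ := h
        _ = _ := by ring
    have hQr : (Q t).toReal ≤ ((cV ^ 2 * ENNReal.ofReal M * (ENNReal.ofReal M * volume (boxN N L))).toReal) *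
        t * t := by
      have h := ENNReal.toReal_mono (ENNReal.mul_ne_top (ENNReal.mul_ne_top (ENNReal.pow_ne_top
        (ENNReal.mul_ne_top hcV_top ENNReal.ofReal_ne_top)) ENNReal.ofReal_ne_top)
        (ENNReal.mul_ne_top ENNReal.ofReal_ne_top (volume_boxN_lt_top N L).ne)) (hQle t)
      rw [ENNReal.toReal_mul, ENNReal.toReal_mul, mul_pow, ENNReal.toReal_mul, ENNReal.toReal_pow,
        ENNReal.toReal_pow, ENNReal.toReal_ofReal ht'.le] at h
      rw [ENNReal.toReal_mul, ENNReal.toReal_mul, ENNReal.toReal_pow]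
      calc (Q t).toReal ≤ _ := h
        _ = _ := by ring
    -- `(J/t).toReal = J.toReal / t`
    have hJdiv : ((J t) / (t : ℝ≥0∞)).toReal = (J t).toReal / t := by
      rw [ENNReal.toReal_div, ENNReal.coe_toReal]
    rw [hJdiv]
    -- combine: sqIncr.toReal/2 + D ≤ lam t, J ≤ D + Q + K
    have hfin : (sqIncr t φ).toReal / 2 ≤ lam * t - (J t).toReal + (K t).toReal + (Q t).toReal := by
      linarith
    rw [div_le_iff₀ (by positivity : (0 : ℝ) < 2 * t)]
    have halg : (lam - (J t).toReal / t +
        (ENNReal.ofReal M * (cV * ENNReal.ofReal M)).toReal * (S t).toReal +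
        ((cV ^ 2 * ENNReal.ofReal M * (ENNReal.ofReal M * volume (boxN N L))).toReal) * t) * (2 * t) =
        2 * (lam * t - (J t).toReal +
          (ENNReal.ofReal M * (cV * ENNReal.ofReal M)).toReal * (S t).toReal * t +
          ((cV ^ 2 * ENNReal.ofReal M * (ENNReal.ofReal M * volume (boxN N L))).toReal) * t * t) := by
      field_simp
    rw [halg]
    linarith [hKr, hQr, hfin]
  -- the limit of the right-hand side
  have hlimJ : Tendsto (fun t : ℝ≥0 => ((J t) / (t : ℝ≥0∞)).toReal) (𝓝[>] 0) (𝓝 I.toReal) :=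
    (ENNReal.tendsto_toReal hI_top).comp (tendsto_interactionTerm_div (N := N) hv hC hcont hsupp)
  have hlimS : Tendsto (fun t : ℝ≥0 => (S t).toReal) (𝓝[>] 0) (𝓝 0) := by
    have h := ((ENNReal.tendsto_toReal ENNReal.zero_ne_top).comp
      (tendsto_setLIntegral_not_survives (N := N) L)).mono_left
      (nhdsWithin_le_nhds (s := Ioi (0 : ℝ≥0)))
    rwa [ENNReal.toReal_zero] at h
  have hlimt : Tendsto (fun t : ℝ≥0 => (t : ℝ)) (𝓝[>] 0) (𝓝 0) := by
    have := (NNReal.continuous_coe.tendsto (0 : ℝ≥0)).mono_left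
      (nhdsWithin_le_nhds (s := Ioi (0 : ℝ≥0)))
    simpa using this
  have hlim : Tendsto (fun t : ℝ≥0 => lam - ((J t) / (t : ℝ≥0∞)).toReal +
      (ENNReal.ofReal M * (cV * ENNReal.ofReal M)).toReal * (S t).toReal +
      ((cV ^ 2 * ENNReal.ofReal M * (ENNReal.ofReal M * volume (boxN N L))).toReal) * t)
      (𝓝[>] 0) (𝓝 (lam - I.toReal)) := by
    have h := ((tendsto_const_nhds (x := lam)).sub hlimJ).add
      ((hlimS.const_mul ((ENNReal.ofReal M * (cV * ENNReal.ofReal M)).toReal)).add (hlimt.const_mul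
        ((cV ^ 2 * ENNReal.ofReal M * (ENNReal.ofReal M * volume (boxN N L))).toReal)))
    simp only [mul_zero, add_zero] at h
    refine h.congr fun t => ?_
    ring
  have hev := hlim.eventually (gt_mem_nhds (by linarith : lam - I.toReal < lam - I.toReal + ε))
  have hpos : ∀ᶠ t : ℝ≥0 in 𝓝[>] (0 : ℝ≥0), 0 < t := eventually_mem_nhdsWithin
  filter_upwards [hev, hpos] with t ht htpos
  have ht' : (0 : ℝ) < t := htpos
  have hr := (hreal t htpos).trans ht.le
  -- back to `[0, ∞]`
  have hX : (ENNReal.ofReal (2 * t))⁻¹ * sqIncr t φ = ENNReal.ofReal ((sqIncr t φ).toReal / (2 * t)) := by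
    rw [ENNReal.ofReal_div_of_pos (by positivity), ENNReal.ofReal_toReal (hsq_top t),
      ENNReal.div_eq_inv_mul, ENNReal.ofReal_mul zero_le_two, ENNReal.ofReal_ofNat,
      ENNReal.ofReal_coe_nnreal]
  rw [hX]
  exact ENNReal.ofReal_le_ofReal hr

end Upper

end Literature.MathematicalPhysics.QuantumManyBody.BoseGas
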